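import Literature.MathematicalPhysics.QuantumFieldTheory.Balaban1983to89.B9CubeLettersOpsL0
import Literature.MathematicalPhysics.QuantumFieldTheory.Balaban1983to89.B9B8AveragingJunction
import Literature.MathematicalPhysics.QuantumFieldTheory.Balaban1983to89.B9KnitTransporterUnitaryY

/-!
# `Node00.OpsYCubeKnitPar` — THE KNIT's SITE TRANSPORTER TABLE READ AT AN ARBITRARY LEVEL FUNCTION, AND ITS CUBE-SEQUENCE INSTANCE `parKnitCubeY i □`

[Balaban1985BackgroundPropagators] (3.19) p. 393 transports the averaging operation `Q(U)` of a multilevel family `{Ω_j}` along the contours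
`Γ^{(j)}_{y,x}` from the reference point `y` of the `L^j`-block `B^j(y)` containing `x`, **`j` THE LEVEL OF THE FAMILY AT `x`**; (3.24) p. 394 builds
`Δ′_a(U) = Δ(U) + Σ_j a_j (L^jη)^{−2} Q′_j(U)* 1_{Λ_j} Q′_j(U)` from them, and p. 408 («a sequence `{Ω_n(□)}_{n=0,…,j+1}` of domains») ∕ p. 409 l. 1–5 repeat
the construction FOR THE CUBE SEQUENCE `{Ω_n(□)}` of a cover cube `□ ⊂ B^j(Λ_j)`, whose levels `lev_□ = min(lev, prof_□)` DROP below the member's away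
from `□` (`B9CubeSequence408.cubeFam`, `B9CubeLettersOpsL0.levCubeY`).

WHY THIS FILE (the (T-□) exchange of the N06 desk, 2026-08-31).  def-Y's knit letter `B9B8AveragingJunction.parKnitY i U z w` reads the MEMBER's level
`levY i`: its forward leg fires iff `z` is the corner of the `L^{lev w}`-block of `w`.  The cube sequence's averaging transporter
`B9CubeLettersOpsL0.avgTrCubeY i □ par U z w = par U z c · par U c w` goes through the corner `c` of the `L^{lev_□ z}`-block; at `par := parKnitY i` and a
site with `lev_□ z < lev z` (all of `Ω₀(□) ∖ NearH(□)`, p. 408) the corner `c` is NOT a member-level corner of `z` in general, so both legs read the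
`else 1` branch: the pinned operator `Δ′_{a,□}(U; parKnitY)` has FLAT averaging legs off `NearH(□)` — harmless for the identity ∕ `U = 1` ∕ positivity
rows (they never read the legs' values), wrong for any `U ≠ 1` estimate row of [B9] Thm 3.1 ∕ (3.105) at the cube.  Print's object reads the legs AT THE
CUBE SEQUENCE's OWN LEVELS.  This file types that object once, GENERICALLY IN THE LEVEL FUNCTION, and instantiates it:

* §1 for any `lv : SiteY i → ℕ`: the composite leg `knitTL i lv T w := compT L T (lv w) (blk (L^{lv w}) w) w` (`U(Γ^{(lv w)}_{y,w})`), the table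
  `parOfTL i lv T z w` (forward leg ∕ inverse leg ∕ `1`, as `parOfT` with `lv` for `levY i`) and the letter ★ `parKnitLY i lv : SiteParY 𝔸 i` (at the
  knit's level transporters `bgT L (liftCfg U)`); the DICTIONARY `knitT = knitTL (levY i)`, `parOfT = parOfTL (levY i)`, `parKnitY = parKnitLY (levY i)`
  (all `rfl`); the laws: `parOfTL_corner_left`, `parOfTL_one_legs` ∕ `parKnitLY_one`, level-agreement `parOfTL_congr_lev` ∕ `parKnitLY_congr_lev`,
  `G`-valuedness `knitTL_mem` ∕ `parOfTL_mem` ∕ `parKnitLY_mem_unitaryUnits(_of_le)`; and, under CORNER-CONSTANCY of the level function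
  `hlv : ∀ z, lv (cornerY i (lv z) z) = lv z` (every multilevel family has it: territories are unions of blocks of their own level):
  `knitTL_cornerY = 1`, `parOfTL_corner_right = (knitTL z)⁻¹`, ★ `parOfTL_inv` ∕ `parKnitLY_inv` (inverse-symmetry, the `hinv` socket of def-Y's
  symmetry ∕ positivity clauses), ★★ `parOfTL_corner_mul` ∕ `parKnitLY_corner_mul`: THROUGH A SHARED CORNER THE TABLE READS PRINT's LEGS
  `U(Γ_{y,z})⁻¹ · U(Γ_{y,w})` ((3.19) with (3.24)'s `Q′* … Q′`).
* §2 the CUBE-SEQUENCE INSTANCE ★★ `parKnitCubeY i □ := parKnitLY i (levCubeY i □)` with `hlv` DISCHARGED (`levCubeY_cornerY`, from the level-0 torus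
  lineage `B6MultiLevelTorusOperatorL0.TDomains.lev_eq_of_blk_eq`; member twin `levY_cornerY`): `parKnitCubeY_one` (the `hpar` socket of the `U = 1`
  clauses of `Node00.OpsYCubeDirInverse`), ★ `parKnitCubeY_inv` (the `hinv` socket), ★★ `avgTrCubeY_parKnitCubeY(_of_corner)`: ON THE SUPPORT OF THE
  CUBE COEFFICIENT the cube sequence's averaging transporter at `parKnitCubeY` IS `U(Γ^{(lev_□)}_{y,z})⁻¹ · U(Γ^{(lev_□)}_{y,w})` — non-trivial legs on
  ALL of `Ω₀(□)`, the repair of (T-□) — ★ `parKnitCubeY_eq_parKnitY_of_nearH`: on `NearH(□) × NearH(□)` (where `lev_□ = lev`,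
  `B9CubeLettersOpsL0.levCubeY_eq_levY_of_nearH`) the cube table IS the member table, so every row already proved at `parKnitY` near `□` transfers
  verbatim; `parKnitCubeY_mem_unitaryUnits(_of_le)` (the `hGU` socket of the symmetry files).

* §3 the SYMMETRY CLAUSES of the cube letters at `parKnitCubeY` for every `G`-valued `U`, `G ≤ U(N)`, no hypothesis on the legs:
  `deltaPrimeACubeY_parKnitCubeY_isSymmTr_of_le`, `GpCubeY_parKnitCubeY_isSymmTr_of_le`, ★★ `GpDirY_parKnitCubeY_isSymmTr_of_le` (the consumer's `hOsym`
  at the cube letter; twins of `B9KnitTransporterUnitaryY` §2 at `parKnitY`).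

RE-PIN for the `U ≠ 1` rows of the N06 junction: `G′_{□,S}(U) := Node00.OpsYCubeDirInverse.GpDirY i □ (parKnitCubeY i □) S`,
`Pl := B9Eq3104CutoffCommutators.DPDsY i (parKnitCubeY i □) (G′_{□,S})`; the identity ∕ `U = 1` ∕ positivity rows at `parKnitY` stand as they are.

All statements are definitions and bookkeeping identities of print's construction; nothing analytic is claimed.
-/

noncomputable section

namespace Literature.MathematicalPhysics.QuantumFieldTheory.Balaban1983to89.Node00.OpsYCubeKnitPar

open B7Prop1Explicit renaming Site → LSite
open B7Prop2Explicit (unitaryUnits mem_unitaryUnits)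
open Literature.MathematicalPhysics.QuantumLattice (blockBase)
open B8Eq119TwistedAxial (bgT bgT_one)
open B4Reflection242 (boxDom mem_boxDom blk blk_mul)
open B6MultiLevelBoxOperator (N0)
open B6GlobalChartV1 (PV)
open B6KLevelCensusIndexV1 (KIdx)
open B6Cover236MultiLevelBlocks (cubes)
open B9B8CarrierDictionary (liftCfg liftCfg_mem)
open B9B8AveragingKernelZd (compT compT_one_legs)
open B9B8KnitLetterRegular (compT_mem)
open B9B8AveragingJunction (knitT parOfT parKnitY compT_blockBase bgT_blockBase)
open B9KnitTransporterUnitaryY (bgT_liftCfg_mem_unitaryUnits)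
open B9CubeSequence408 (NearH)
open B9CubeLettersOpsL0 (cubeFamY levCubeY levCubeY_eq_levY_of_nearH avgCoeffCubeY avgTrCubeY)
open B9Thm311ReadingCoords (IsSymmTr)
open B9Thm311CubeLettersFirstThree (cornerY_eq_of_avgCoeffCubeY_ne_zero deltaPrimeACubeY_isSymmTr_of_inv_symm GpCubeY_isSymmTr)
open B9CubeLettersOpsL0 (deltaPrimeACubeY GpCubeY)
open Node00
open Node00.OpsYCubeDirInverse (GpDirY)
open Node00.OpsYCubeDirInverseSymm (GpDirY_isSymmTr_of_inv_symm)

variable {d ℓ : ℕ} {hd : 1 ≤ d + 1} {hL : Odd (ℓ + 1) ∧ 1 < ℓ + 1} {b₀ b₁ : ℝ}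
variable {𝔸 : Type} [NormedRing 𝔸] [NormedAlgebra ℂ 𝔸] [CompleteSpace 𝔸]

/-! ## §0 Corner bookkeeping at an arbitrary level -/

section Corner

variable (i : KIdx d ℓ hd hL b₀ b₁)

/-- the corner of the `L^j`-block of `z` lies in that block: same `L^j`-label. [cite: Balaban1985BackgroundPropagators, (3.19) p.393, bookkeeping] -/
theorem blk_cornerY (j : ℕ) (z : SiteY i) : blk ((ℓ + 1) ^ j) (cornerY i j z).1 = blk ((ℓ + 1) ^ j) z.1 := by
  have h : (cornerY i j z).1 = fun μ => (((ℓ + 1) ^ j : ℕ) : ℤ) * blk ((ℓ + 1) ^ j) z.1 μ := rfl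
  rw [h]
  exact blk_mul (Nat.one_le_pow _ _ (Nat.succ_pos ℓ)) _

/-- the corner, as a block base: `c = L^j · (z's L^j-label)`. [cite: Balaban1985BackgroundPropagators, (3.19) p.393, bookkeeping] -/
theorem cornerY_val_eq_blockBase (j : ℕ) (z : SiteY i) : (cornerY i j z).1 = blockBase ((ℓ + 1) ^ j) (blk ((ℓ + 1) ^ j) z.1) := rfl

/-- two sites with one `L^j`-label have one `L^j`-corner. [cite: Balaban1985BackgroundPropagators, (3.19) p.393, bookkeeping] -/
theorem cornerY_eq_of_blk_eq {j : ℕ} {z w : SiteY i} (h : blk ((ℓ + 1) ^ j) w.1 = blk ((ℓ + 1) ^ j) z.1) : cornerY i j w = cornerY i j z :=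
  Subtype.ext (funext fun μ => by rw [cornerY_apply, cornerY_apply, h])

/-- the corner map at scale `L^j` is idempotent. [cite: Balaban1985BackgroundPropagators, (3.19) p.393, bookkeeping] -/
theorem cornerY_cornerY (j : ℕ) (z : SiteY i) : cornerY i j (cornerY i j z) = cornerY i j z :=
  cornerY_eq_of_blk_eq i (blk_cornerY i j z)

end Corner

/-! ## §1 The knit table at an arbitrary level function `lv` -/

section Level

variable (i : KIdx d ℓ hd hL b₀ b₁) (lv : SiteY i → ℕ)

/-- `U(Γ^{(lv w)}_{y,w})`: the knit's composite transporter to `w` from the corner of its `L^{lv w}`-block, for a level-transporter family `T` on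
`ℤ^{d+1}` — `B9B8AveragingJunction.knitT` with the level function `lv` for the member's `levY i`. [cite: Balaban1985BackgroundPropagators, (3.19) p.393, p.408; Balaban1985Averaging, (52)–(53) p.27] -/
def knitTL (T : ℕ → (Fin (d + 1) → ℤ) → (Fin (d + 1) → ℤ) → 𝔸ˣ) (w : SiteY i) : 𝔸ˣ :=
  compT (ℓ + 1) T (lv w) (blk ((ℓ + 1) ^ lv w) w.1) w.1

open Classical in
/-- the site transporter table at the level function `lv`: `U(Γ_{z,w}) := U(Γ^{(lv w)}_{y,w})` when `z` is the corner of `w`'s `L^{lv w}`-block, the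
inverse `U(Γ^{(lv z)}_{y,z})⁻¹` when `w` is the corner of `z`'s block (the leg of `Q′*`), `1` otherwise — `B9B8AveragingJunction.parOfT` with `lv` for
`levY i`. [cite: Balaban1985BackgroundPropagators, (3.19) p.393, (3.24)–(3.25) pp.394–395, p.409] -/
def parOfTL (T : ℕ → (Fin (d + 1) → ℤ) → (Fin (d + 1) → ℤ) → 𝔸ˣ) (z w : SiteY i) : 𝔸ˣ :=
  if cornerY i (lv w) w = z then knitTL i lv T w else if cornerY i (lv z) z = w then (knitTL i lv T z)⁻¹ else 1

/-- ★ **`parKnitLY i lv`: THE KNIT's TRANSPORTERS READ AT THE LEVEL FUNCTION `lv`, AS A def-Y LETTER** — `parOfTL` at the knit's level transporters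
`bgT L U₀` of the periodic lift `U₀ = liftCfg U`. [cite: Balaban1985BackgroundPropagators, (3.19) p.393, p.409; Balaban1985RegularSpaces, (1.29) p.81] -/
def parKnitLY : SiteParY 𝔸 i := fun U => parOfTL i lv (bgT (ℓ + 1) (liftCfg U))

/-! ### dictionary with the member table (`lv := levY i`) -/

omit [NormedAlgebra ℂ 𝔸] [CompleteSpace 𝔸] in
/-- at the member's level function the leg is def-Y's `knitT`. [cite: Balaban1985BackgroundPropagators, (3.19) p.393, dictionary] -/
theorem knitT_eq_knitTL (T : ℕ → (Fin (d + 1) → ℤ) → (Fin (d + 1) → ℤ) → 𝔸ˣ) : knitT i T = knitTL i (levY i) T := rfl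

omit [NormedAlgebra ℂ 𝔸] [CompleteSpace 𝔸] in
/-- at the member's level function the table is def-Y's `parOfT`. [cite: Balaban1985BackgroundPropagators, (3.19) p.393, dictionary] -/
theorem parOfT_eq_parOfTL (T : ℕ → (Fin (d + 1) → ℤ) → (Fin (d + 1) → ℤ) → 𝔸ˣ) : parOfT i T = parOfTL i (levY i) T := rfl

/-- ★ at the member's level function the letter is def-Y's `parKnitY`. [cite: Balaban1985BackgroundPropagators, (3.19) p.393, dictionary] -/
theorem parKnitY_eq_parKnitLY : parKnitY i = parKnitLY (𝔸 := 𝔸) i (levY i) := rfl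

/-! ### laws needing no geometry -/

omit [NormedAlgebra ℂ 𝔸] [CompleteSpace 𝔸] in
/-- ★ THE FORWARD LEG: from the corner of `w`'s `L^{lv w}`-block to `w` the table is the composite transporter. [cite: Balaban1985BackgroundPropagators, (3.19) p.393] -/
theorem parOfTL_corner_left (T : ℕ → (Fin (d + 1) → ℤ) → (Fin (d + 1) → ℤ) → 𝔸ˣ) (w : SiteY i) :
    parOfTL i lv T (cornerY i (lv w) w) w = knitTL i lv T w := by
  unfold parOfTL; rw [if_pos rfl]

omit [NormedAlgebra ℂ 𝔸] [CompleteSpace 𝔸] in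
/-- with trivial legs the table is trivial. [cite: Balaban1985BackgroundPropagators, Cor. 3.5 p.407 (U = 1), bookkeeping] -/
theorem parOfTL_one_legs (z w : SiteY i) : parOfTL i lv (fun _ _ _ => (1 : 𝔸ˣ)) z w = 1 := by
  unfold parOfTL knitTL
  rw [compT_one_legs, compT_one_legs, inv_one]
  split_ifs <;> rfl

/-- ★ AT `U = 1` THE LETTER IS TRIVIAL (`parKnitLY lv 1 = 1`; the `hpar` premise of def-Y's `U = 1` clauses). [cite: Balaban1985BackgroundPropagators, p.395, Cor. 3.5 p.407] -/
theorem parKnitLY_one (z w : SiteY i) : parKnitLY i lv (fun _ _ => (1 : 𝔸ˣ)) z w = 1 := by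
  have h1 : bgT (ℓ + 1) (liftCfg (P := PV d ℓ i.m i.K hd hL) fun _ _ => (1 : 𝔸ˣ)) = fun _ _ _ => 1 := bgT_one (ℓ + 1)
  show parOfTL i lv (bgT (ℓ + 1) (liftCfg (P := PV d ℓ i.m i.K hd hL) fun _ _ => (1 : 𝔸ˣ))) z w = 1
  rw [h1]
  exact parOfTL_one_legs i lv z w

omit [NormedAlgebra ℂ 𝔸] [CompleteSpace 𝔸] in
/-- the leg to `w` depends on the level function only through `lv w`. [cite: Balaban1985BackgroundPropagators, (3.19) p.393, bookkeeping] -/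
theorem knitTL_congr_lev {lv lv' : SiteY i → ℕ} (T : ℕ → (Fin (d + 1) → ℤ) → (Fin (d + 1) → ℤ) → 𝔸ˣ) {w : SiteY i} (hw : lv w = lv' w) :
    knitTL i lv T w = knitTL i lv' T w := by
  unfold knitTL; rw [hw]

omit [NormedAlgebra ℂ 𝔸] [CompleteSpace 𝔸] in
/-- ★ LEVEL AGREEMENT: the entry `(z, w)` of the table depends on the level function only through `lv z` and `lv w` — two level functions agreeing at
`z` and at `w` give the same transporter. [cite: Balaban1985BackgroundPropagators, (3.19) p.393, p.409, bookkeeping] -/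
theorem parOfTL_congr_lev {lv lv' : SiteY i → ℕ} (T : ℕ → (Fin (d + 1) → ℤ) → (Fin (d + 1) → ℤ) → 𝔸ˣ) {z w : SiteY i} (hz : lv z = lv' z)
    (hw : lv w = lv' w) : parOfTL i lv T z w = parOfTL i lv' T z w := by
  unfold parOfTL knitTL
  simp only [hz, hw]

/-- ★ the same for the letters. [cite: Balaban1985BackgroundPropagators, (3.19) p.393, p.409, bookkeeping] -/
theorem parKnitLY_congr_lev {lv lv' : SiteY i → ℕ} (U : CfgY 𝔸 i) {z w : SiteY i} (hz : lv z = lv' z) (hw : lv w = lv' w) :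
    parKnitLY i lv U z w = parKnitLY i lv' U z w :=
  parOfTL_congr_lev i _ hz hw

omit [NormedAlgebra ℂ 𝔸] [CompleteSpace 𝔸] in
/-- composite legs of `G`-valued level transporters are `G`-valued. [cite: Balaban1985BackgroundPropagators, (3.19) p.393, p.390 («with values in G»), bookkeeping] -/
theorem knitTL_mem {G : Subgroup 𝔸ˣ} (T : ℕ → (Fin (d + 1) → ℤ) → (Fin (d + 1) → ℤ) → 𝔸ˣ) (hT : ∀ j y x, T j y x ∈ G) (w : SiteY i) :
    knitTL i lv T w ∈ G := by
  unfold knitTL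
  exact compT_mem (ℓ + 1) _ (fun j' _ y x => hT j' y x) _ _

omit [NormedAlgebra ℂ 𝔸] [CompleteSpace 𝔸] in
/-- the table of `G`-valued level transporters is `G`-valued (a leg, an inverse leg, or `1`). [cite: Balaban1985BackgroundPropagators, (3.19) p.393, p.390, bookkeeping] -/
theorem parOfTL_mem {G : Subgroup 𝔸ˣ} (T : ℕ → (Fin (d + 1) → ℤ) → (Fin (d + 1) → ℤ) → 𝔸ˣ) (hT : ∀ j y x, T j y x ∈ G) (z w : SiteY i) :
    parOfTL i lv T z w ∈ G := by
  unfold parOfTL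
  split_ifs
  · exact knitTL_mem i lv T hT w
  · exact G.inv_mem (knitTL_mem i lv T hT z)
  · exact G.one_mem

/-! ### laws under corner-constancy of the level function -/

omit [NormedAlgebra ℂ 𝔸] [CompleteSpace 𝔸] in
/-- the composite transporter to a CORNER is `1` (legs trivial at block bases), for a level function constant at its corners.
[cite: Balaban1985BackgroundPropagators, (3.19) p.393, bookkeeping] -/
theorem knitTL_cornerY (T : ℕ → (Fin (d + 1) → ℤ) → (Fin (d + 1) → ℤ) → 𝔸ˣ) (hT : ∀ j y, T j y (blockBase (ℓ + 1) y) = 1)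
    (hlv : ∀ z : SiteY i, lv (cornerY i (lv z) z) = lv z) (z : SiteY i) : knitTL i lv T (cornerY i (lv z) z) = 1 := by
  unfold knitTL
  rw [hlv z, blk_cornerY, cornerY_val_eq_blockBase]
  exact compT_blockBase (Nat.succ_pos ℓ) T hT (lv z) _

omit [NormedAlgebra ℂ 𝔸] [CompleteSpace 𝔸] in
/-- ★ THE BACKWARD LEG: from `z` to the corner of its `L^{lv z}`-block the table is the INVERSE composite transporter.
[cite: Balaban1985BackgroundPropagators, (3.24)–(3.25) pp.394–395 («Q′*»)] -/
theorem parOfTL_corner_right (T : ℕ → (Fin (d + 1) → ℤ) → (Fin (d + 1) → ℤ) → 𝔸ˣ) (hT : ∀ j y, T j y (blockBase (ℓ + 1) y) = 1)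
    (hlv : ∀ z : SiteY i, lv (cornerY i (lv z) z) = lv z) (z : SiteY i) :
    parOfTL i lv T z (cornerY i (lv z) z) = (knitTL i lv T z)⁻¹ := by
  unfold parOfTL
  have hcc : cornerY i (lv (cornerY i (lv z) z)) (cornerY i (lv z) z) = cornerY i (lv z) z := by rw [hlv z, cornerY_cornerY]
  by_cases hz : cornerY i (lv z) z = z
  · -- `z` is a corner: both legs are `1`
    rw [hcc, if_pos hz]
    have h1 : knitTL i lv T z = 1 := by rw [← hz]; exact knitTL_cornerY i lv T hT hlv z
    rw [hz, h1, inv_one]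
  · rw [hcc, if_neg hz, if_pos rfl]

omit [NormedAlgebra ℂ 𝔸] [CompleteSpace 𝔸] in
/-- ★ **THE TABLE IS INVERSE-SYMMETRIC**: `U(Γ_{z,w}) = U(Γ_{w,z})⁻¹` — the `hinv` premise of def-Y's symmetry, positivity and Dirichlet-inverse
clauses at a transporter letter. [cite: Balaban1985BackgroundPropagators, (3.25) p.395 («Δ′_a is positive»), (3.19) p.393] -/
theorem parOfTL_inv (T : ℕ → (Fin (d + 1) → ℤ) → (Fin (d + 1) → ℤ) → 𝔸ˣ) (hT : ∀ j y, T j y (blockBase (ℓ + 1) y) = 1)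
    (hlv : ∀ z : SiteY i, lv (cornerY i (lv z) z) = lv z) (z w : SiteY i) : parOfTL i lv T z w = (parOfTL i lv T w z)⁻¹ := by
  by_cases h1 : cornerY i (lv w) w = z
  · rw [← h1, parOfTL_corner_left, parOfTL_corner_right i lv T hT hlv, inv_inv]
  · by_cases h2 : cornerY i (lv z) z = w
    · rw [← h2, parOfTL_corner_right i lv T hT hlv, parOfTL_corner_left]
    · unfold parOfTL
      rw [if_neg h1, if_neg h2, if_neg h2, if_neg h1, inv_one]

/-- ★ the letter is inverse-symmetric, for a level function constant at its corners. [cite: Balaban1985BackgroundPropagators, (3.25) p.395, (3.19) p.393] -/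
theorem parKnitLY_inv (hlv : ∀ z : SiteY i, lv (cornerY i (lv z) z) = lv z) (U : CfgY 𝔸 i) (z w : SiteY i) :
    parKnitLY i lv U z w = (parKnitLY i lv U w z)⁻¹ :=
  parOfTL_inv i lv _ (fun j y => bgT_blockBase (ℓ + 1) (liftCfg U) j y) hlv z w

omit [NormedAlgebra ℂ 𝔸] [CompleteSpace 𝔸] in
/-- ★★ **THROUGH A SHARED CORNER THE TABLE READS PRINT's LEGS**: for `w` in the `L^{lv z}`-block of `z` at one level (`c` their common corner),
`U(Γ_{z,c}) · U(Γ_{c,w}) = U(Γ^{(lv z)}_{y,z})⁻¹ · U(Γ^{(lv w)}_{y,w})` — the transporter of the averaging term `Q′* 1 Q′` of (3.24).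
[cite: Balaban1985BackgroundPropagators, (3.19) p.393, (3.24) p.394] -/
theorem parOfTL_corner_mul (T : ℕ → (Fin (d + 1) → ℤ) → (Fin (d + 1) → ℤ) → 𝔸ˣ) (hT : ∀ j y, T j y (blockBase (ℓ + 1) y) = 1)
    (hlv : ∀ z : SiteY i, lv (cornerY i (lv z) z) = lv z) {z w : SiteY i} (hc : cornerY i (lv w) w = cornerY i (lv z) z) :
    parOfTL i lv T z (cornerY i (lv z) z) * parOfTL i lv T (cornerY i (lv z) z) w = (knitTL i lv T z)⁻¹ * knitTL i lv T w := by
  rw [parOfTL_corner_right i lv T hT hlv z, ← hc, parOfTL_corner_left]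

/-- ★★ the same for the letter: `parKnitLY lv U z c · parKnitLY lv U c w = U(Γ^{(lv z)}_{y,z})⁻¹ · U(Γ^{(lv w)}_{y,w})` at the knit's level transporters.
[cite: Balaban1985BackgroundPropagators, (3.19) p.393, (3.24) p.394] -/
theorem parKnitLY_corner_mul (hlv : ∀ z : SiteY i, lv (cornerY i (lv z) z) = lv z) (U : CfgY 𝔸 i) {z w : SiteY i}
    (hc : cornerY i (lv w) w = cornerY i (lv z) z) :
    parKnitLY i lv U z (cornerY i (lv z) z) * parKnitLY i lv U (cornerY i (lv z) z) w =
      (knitTL i lv (bgT (ℓ + 1) (liftCfg U)) z)⁻¹ * knitTL i lv (bgT (ℓ + 1) (liftCfg U)) w :=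
  parOfTL_corner_mul i lv _ (fun j y => bgT_blockBase (ℓ + 1) (liftCfg U) j y) hlv hc

/-- the member's level function is constant at its corners (territories are unions of blocks of their own level).
[cite: Balaban1984PropagatorsII, (2.1)+(2.3) p.224, bookkeeping] -/
theorem levY_cornerY (z : SiteY i) : levY i (cornerY i (levY i z) z) = levY i z :=
  (toKT i).D.lev_eq_of_blk_eq z.2 (cornerY i (levY i z) z).2 (blk_cornerY i _ z)

end Level

/-! ### `U(N)`-valuedness of the letter (matrix algebra, the `L²`-operator norm instances) -/

open scoped Matrix Matrix.Norms.L2Operator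

section Unitary

variable {N : ℕ} (i : KIdx d ℓ hd hL b₀ b₁) (lv : SiteY i → ℕ) {G : Subgroup (Matrix (Fin N) (Fin N) ℂ)ˣ}

/-- ★ the letter at the level function `lv` is `U(N)`-valued for every `U(N)`-valued background (every level, no window).
[cite: Balaban1985BackgroundPropagators, (3.19) p.393, p.390 («with values in G»)] -/
theorem parKnitLY_mem_unitaryUnits {U : CfgY (Matrix (Fin N) (Fin N) ℂ) i} (hU : ∀ μ x, U μ x ∈ unitaryUnits (Matrix (Fin N) (Fin N) ℂ))
    (z w : SiteY i) : parKnitLY i lv U z w ∈ unitaryUnits (Matrix (Fin N) (Fin N) ℂ) :=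
  parOfTL_mem i lv _ (fun j y x => bgT_liftCfg_mem_unitaryUnits i hU j y x) z w

/-- for a `G`-valued `U`, `G ≤ U(N)`: the letter is `U(N)`-valued (the `hGU` socket of the symmetry files). [cite: Balaban1985BackgroundPropagators, (3.19) p.393, p.390] -/
theorem parKnitLY_mem_unitaryUnits_of_le (hGU : G ≤ unitaryUnits (Matrix (Fin N) (Fin N) ℂ)) {U : CfgY (Matrix (Fin N) (Fin N) ℂ) i}
    (hU : ∀ μ x, U μ x ∈ G) (z w : SiteY i) : parKnitLY i lv U z w ∈ unitaryUnits (Matrix (Fin N) (Fin N) ℂ) :=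
  parKnitLY_mem_unitaryUnits i lv (fun μ x => hGU (hU μ x)) z w

/-- matrix edition: `U(Γ_{z,w})⋆ U(Γ_{z,w}) = 1`. [cite: Balaban1985BackgroundPropagators, (3.19) p.393, bookkeeping] -/
theorem coe_parKnitLY_mem_unitary {U : CfgY (Matrix (Fin N) (Fin N) ℂ) i} (hU : ∀ μ x, U μ x ∈ unitaryUnits (Matrix (Fin N) (Fin N) ℂ))
    (z w : SiteY i) :
    ((parKnitLY i lv U z w : (Matrix (Fin N) (Fin N) ℂ)ˣ) : Matrix (Fin N) (Fin N) ℂ) ∈ unitary (Matrix (Fin N) (Fin N) ℂ) :=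
  mem_unitaryUnits.mp (parKnitLY_mem_unitaryUnits i lv hU z w)

end Unitary

/-! ## §2 The cube-sequence instance `parKnitCubeY i □` -/

section Cube

variable (i : KIdx d ℓ hd hL b₀ b₁) (q : ↥(cubes (toKT i).D.toDomains))

/-- the cube family's level function `lev_□` is constant at its corners (its territories `Ω_n(□) ∖ Ω_{n+1}(□)`, `Λ₀` included, are unions of blocks of
their own level — the level-0 torus lineage). [cite: Balaban1985BackgroundPropagators, p.408; Balaban1984PropagatorsII, (2.1)+(2.3) p.224, bookkeeping] -/
theorem levCubeY_cornerY (z : SiteY i) : levCubeY i q (cornerY i (levCubeY i q z) z) = levCubeY i q z :=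
  (cubeFamY i q).lev_eq_of_blk_eq z.2 (cornerY i (levCubeY i q z) z).2 (blk_cornerY i _ z)

/-- ★★ **`parKnitCubeY i □`: THE KNIT's TRANSPORTERS READ AT THE CUBE SEQUENCE's LEVELS `lev_□`** — the site transporter letter of print's
`Δ′_{a,□}(U)` ∕ `G_□(U)` (p. 409 l. 1–5: (3.19), (3.24) for the sequence `{Ω_n(□)}`): forward leg `U(Γ^{(lev_□ w)}_{y,w})` from the corner of the
`L^{lev_□ w}`-block, inverse leg back, `1` otherwise. [cite: Balaban1985BackgroundPropagators, (3.19) p.393, (3.24) p.394, pp.408–409] -/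
def parKnitCubeY : SiteParY 𝔸 i := parKnitLY i (levCubeY i q)

/-- `U(Γ^{(lev_□ w)}_{y,w})`: the cube sequence's knit leg to `w` at the background `U`. [cite: Balaban1985BackgroundPropagators, (3.19) p.393, p.409, dictionary] -/
abbrev knitCubeY (U : CfgY 𝔸 i) (w : SiteY i) : 𝔸ˣ := knitTL i (levCubeY i q) (bgT (ℓ + 1) (liftCfg U)) w

/-- the cube letter, unfolded. [cite: Balaban1985BackgroundPropagators, (3.19) p.393, p.409, dictionary] -/
theorem parKnitCubeY_apply (U : CfgY 𝔸 i) (z w : SiteY i) :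
    parKnitCubeY i q U z w = parOfTL i (levCubeY i q) (bgT (ℓ + 1) (liftCfg U)) z w := rfl

/-- ★ AT `U = 1` THE CUBE LETTER IS TRIVIAL (the `hpar` socket of `Node00.OpsYCubeDirInverse.GpDirY_one_eq_liftOpY` and of the `U = 1` clauses of the cube
letters). [cite: Balaban1985BackgroundPropagators, p.395, Cor. 3.5 p.407] -/
theorem parKnitCubeY_one (z w : SiteY i) : parKnitCubeY i q (fun _ _ => (1 : 𝔸ˣ)) z w = 1 := parKnitLY_one i _ z w

/-- ★ THE CUBE LETTER IS INVERSE-SYMMETRIC (the `hinv` socket of `Node00.OpsYCubeDirInverseSymm` ∕ the positivity of `Δ′_{a,□}`).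
[cite: Balaban1985BackgroundPropagators, (3.25) p.395, (3.19) p.393, p.409] -/
theorem parKnitCubeY_inv (U : CfgY 𝔸 i) (z w : SiteY i) : parKnitCubeY i q U z w = (parKnitCubeY i q U w z)⁻¹ :=
  parKnitLY_inv i _ (levCubeY_cornerY i q) U z w

/-- ★★ **THE CUBE SEQUENCE's AVERAGING TRANSPORTER AT `parKnitCubeY` READS PRINT's LEGS**: for `w` and `z` with one `lev_□`-corner,
`avgTrCubeY i □ (parKnitCubeY i □) U z w = U(Γ^{(lev_□ z)}_{y,z})⁻¹ · U(Γ^{(lev_□ w)}_{y,w})` — non-trivial legs on ALL of `Ω₀(□)` (the repair of the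
flat legs of `avgTrCubeY i □ (parKnitY i)` off `NearH(□)`). [cite: Balaban1985BackgroundPropagators, (3.19) p.393, (3.24) p.394, p.409 l.1–5] -/
theorem avgTrCubeY_parKnitCubeY_of_corner (U : CfgY 𝔸 i) {z w : SiteY i}
    (hc : cornerY i (levCubeY i q w) w = cornerY i (levCubeY i q z) z) :
    avgTrCubeY i q (parKnitCubeY i q) U z w = (knitCubeY i q U z)⁻¹ * knitCubeY i q U w := by
  unfold avgTrCubeY
  exact parKnitLY_corner_mul i _ (levCubeY_cornerY i q) U hc

/-- ★★ the same ON THE SUPPORT OF THE CUBE COEFFICIENT `avgCoeffCubeY i □ z w ≠ 0` (one `𝔅_□`-block ⇒ one corner,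
`B9Thm311CubeLettersFirstThree.cornerY_eq_of_avgCoeffCubeY_ne_zero`) — the only entries the averaging term of `Δ′_{a,□}(U)` reads.
[cite: Balaban1985BackgroundPropagators, (3.19) p.393, (3.24) p.394, p.409 l.1–5] -/
theorem avgTrCubeY_parKnitCubeY (U : CfgY 𝔸 i) {z w : SiteY i} (h : avgCoeffCubeY i q z w ≠ 0) :
    avgTrCubeY i q (parKnitCubeY i q) U z w = (knitCubeY i q U z)⁻¹ * knitCubeY i q U w :=
  avgTrCubeY_parKnitCubeY_of_corner i q U (cornerY_eq_of_avgCoeffCubeY_ne_zero i q h)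

/-- ★ **ON `NearH(□) × NearH(□)` THE CUBE LETTER IS THE MEMBER LETTER** (`lev_□ = lev` there, `B9CubeLettersOpsL0.levCubeY_eq_levY_of_nearH`): every row
proved at `parKnitY` for pairs near `□` transfers verbatim. [cite: Balaban1985BackgroundPropagators, p.408 («Ω_{j+1}(□) = □̃³ ∩ B^{j+1}(Λ_{j+1})»), (3.19) p.393] -/
theorem parKnitCubeY_eq_parKnitY_of_nearH (U : CfgY 𝔸 i) {z w : SiteY i} (hz : NearH q z.1) (hw : NearH q w.1) :
    parKnitCubeY i q U z w = parKnitY i U z w :=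
  parKnitLY_congr_lev i U (levCubeY_eq_levY_of_nearH i q hz) (levCubeY_eq_levY_of_nearH i q hw)

/-- pointwise edition: the cube letter agrees with the member letter at every pair where the two level functions agree.
[cite: Balaban1985BackgroundPropagators, (3.19) p.393, p.409, bookkeeping] -/
theorem parKnitCubeY_eq_parKnitY_of_lev_eq (U : CfgY 𝔸 i) {z w : SiteY i} (hz : levCubeY i q z = levY i z) (hw : levCubeY i q w = levY i w) :
    parKnitCubeY i q U z w = parKnitY i U z w :=
  parKnitLY_congr_lev i U hz hw

/-- the cube leg agrees with the member leg at a site where the levels agree (in particular on `NearH(□)`). [cite: Balaban1985BackgroundPropagators, (3.19) p.393, bookkeeping] -/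
theorem knitCubeY_eq_knitT_of_lev_eq (U : CfgY 𝔸 i) {w : SiteY i} (hw : levCubeY i q w = levY i w) :
    knitCubeY i q U w = knitT i (bgT (ℓ + 1) (liftCfg U)) w :=
  knitTL_congr_lev i _ hw

end Cube

section CubeUnitary

variable {N : ℕ} (i : KIdx d ℓ hd hL b₀ b₁) (q : ↥(cubes (toKT i).D.toDomains)) {G : Subgroup (Matrix (Fin N) (Fin N) ℂ)ˣ}

/-- ★ the cube letter is `U(N)`-valued for every `U(N)`-valued background. [cite: Balaban1985BackgroundPropagators, (3.19) p.393, p.390] -/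
theorem parKnitCubeY_mem_unitaryUnits {U : CfgY (Matrix (Fin N) (Fin N) ℂ) i} (hU : ∀ μ x, U μ x ∈ unitaryUnits (Matrix (Fin N) (Fin N) ℂ))
    (z w : SiteY i) : parKnitCubeY i q U z w ∈ unitaryUnits (Matrix (Fin N) (Fin N) ℂ) :=
  parKnitLY_mem_unitaryUnits i _ hU z w

/-- for a `G`-valued `U`, `G ≤ U(N)`: the cube letter is `U(N)`-valued (the `hGU` socket). [cite: Balaban1985BackgroundPropagators, (3.19) p.393, p.390] -/
theorem parKnitCubeY_mem_unitaryUnits_of_le (hGU : G ≤ unitaryUnits (Matrix (Fin N) (Fin N) ℂ)) {U : CfgY (Matrix (Fin N) (Fin N) ℂ) i}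
    (hU : ∀ μ x, U μ x ∈ G) (z w : SiteY i) : parKnitCubeY i q U z w ∈ unitaryUnits (Matrix (Fin N) (Fin N) ℂ) :=
  parKnitLY_mem_unitaryUnits_of_le i _ hGU hU z w

/-- matrix edition: `U(Γ_{z,w})⋆ U(Γ_{z,w}) = 1` for the cube letter. [cite: Balaban1985BackgroundPropagators, (3.19) p.393, bookkeeping] -/
theorem coe_parKnitCubeY_mem_unitary {U : CfgY (Matrix (Fin N) (Fin N) ℂ) i} (hU : ∀ μ x, U μ x ∈ unitaryUnits (Matrix (Fin N) (Fin N) ℂ))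
    (z w : SiteY i) :
    ((parKnitCubeY i q U z w : (Matrix (Fin N) (Fin N) ℂ)ˣ) : Matrix (Fin N) (Fin N) ℂ) ∈ unitary (Matrix (Fin N) (Fin N) ℂ) :=
  coe_parKnitLY_mem_unitary i _ hU z w

end CubeUnitary

/-! ## §3 The symmetry clauses of the cube letters AT `parKnitCubeY`, for every `G`-valued background (`G ≤ U(N)`), no hypothesis on the legs -/

section Symmetry

variable {N : ℕ} (i : KIdx d ℓ hd hL b₀ b₁) (q : ↥(cubes (toKT i).D.toDomains)) {G : Subgroup (Matrix (Fin N) (Fin N) ℂ)ˣ}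

/-- ★ `Δ′_{a,□}(U; parKnitCubeY □)` is symmetric for the trace pairing at every `G`-valued `U`, `G ≤ U(N)`
(`B9Thm311CubeLettersFirstThree.deltaPrimeACubeY_isSymmTr_of_inv_symm` with `hinv` ∕ `hpar` discharged). [cite: Balaban1985BackgroundPropagators, (3.24)–(3.25) p.394, p.409, Thm 3.11 p.416] -/
theorem deltaPrimeACubeY_parKnitCubeY_isSymmTr_of_le (hGU : G ≤ unitaryUnits (Matrix (Fin N) (Fin N) ℂ)) {U : CfgY (Matrix (Fin N) (Fin N) ℂ) i}
    (hU : ∀ μ x, U μ x ∈ G) : IsSymmTr (fun _ => (1 : ℝ)) (deltaPrimeACubeY i q (parKnitCubeY i q) U) :=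
  deltaPrimeACubeY_isSymmTr_of_inv_symm i q le_rfl (parKnitCubeY i q) U (parKnitCubeY_inv i q U)
    (parKnitCubeY_mem_unitaryUnits_of_le i q hGU hU) (fun μ x => hGU (hU μ x))

/-- ★ `G′_□(U; parKnitCubeY □)` is symmetric at every `G`-valued `U`, `G ≤ U(N)`. [cite: Balaban1985BackgroundPropagators, (3.25) p.394, p.409, Thm 3.11 p.416] -/
theorem GpCubeY_parKnitCubeY_isSymmTr_of_le (hGU : G ≤ unitaryUnits (Matrix (Fin N) (Fin N) ℂ)) {U : CfgY (Matrix (Fin N) (Fin N) ℂ) i}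
    (hU : ∀ μ x, U μ x ∈ G) : IsSymmTr (fun _ => (1 : ℝ)) (GpCubeY i q (parKnitCubeY i q) U) :=
  GpCubeY_isSymmTr i q (parKnitCubeY i q) U (deltaPrimeACubeY_parKnitCubeY_isSymmTr_of_le i q hGU hU)

/-- ★★ def-Y's DIRICHLET CUBE INVERSE `G′_{□,S}(U; parKnitCubeY □)` (`Node00.OpsYCubeDirInverse.GpDirY`) is symmetric at every `G`-valued `U`, `G ≤ U(N)` — the
consumer's `hOsym` at the cube letter (`Node00.OpsYCubeDirInverseSymm.GpDirY_isSymmTr_of_inv_symm` with `hinv` ∕ `hpar` discharged).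
[cite: Balaban1985BackgroundPropagators, (3.24)–(3.25) p.394, p.409, Thm 3.11 p.416] -/
theorem GpDirY_parKnitCubeY_isSymmTr_of_le (hGU : G ≤ unitaryUnits (Matrix (Fin N) (Fin N) ℂ)) (S : Finset (SiteY i))
    {U : CfgY (Matrix (Fin N) (Fin N) ℂ) i} (hU : ∀ μ x, U μ x ∈ G) : IsSymmTr (fun _ => (1 : ℝ)) (GpDirY i q (parKnitCubeY i q) S U) :=
  GpDirY_isSymmTr_of_inv_symm i q le_rfl (parKnitCubeY i q) S U (parKnitCubeY_inv i q U) (parKnitCubeY_mem_unitaryUnits_of_le i q hGU hU)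
    (fun μ x => hGU (hU μ x))

end Symmetry

end Literature.MathematicalPhysics.QuantumFieldTheory.Balaban1983to89.Node00.OpsYCubeKnitPar

end
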